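import Mathlib
import HarnessLib
import Summits.Ventures.LatticeQCDFlow.Scoring.RegenerativeCLTCoverage
import Summits.Ventures.LatticeQCDFlow.Scoring.RegenerativeCLTStudentized
import Summits.Ventures.LatticeQCDFlow.Scoring.RestartChainRegenerative

/-!
# Non-equilibrium evolutions restarted from a prior chain: the tour estimator of a record
# observable is ASYMPTOTICALLY NORMAL with the restart-law variance, `√R (Â_R − Π G) ⇒ N(0, e σ²_G)`,
# and the studentised interval has asymptotically exact coverage — from any start

HONEST FRAMING: exact (Metropolis-corrected) sampling algorithms for lattice gauge theory;
figures of merit are autocorrelation/cost numbers at stated couplings and volumes; no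
continuum-physics claim.

Venture `LatticeQCDFlow` (cell pub-lqcd), topic `Scoring`; FANOUT row 8 (`s0-cpn-nemc`, GEN-18 —
the row's own protocol: non-equilibrium evolutions started every `n_between` sweeps of an
equilibrium PRIOR chain; Bonanno–Nada–Vadacchino 2024 NAMED ONLY).  NEW WORK of the cell, not a
published result; no definition is introduced.  Setting of `Scoring/RestartChainRegenerative.lean`
(GEN-17): prior sweep `κ₀` with invariant `π₀` and Doeblin constant `ε₀` (`κ₀(x, ·) ≥ ε₀ π₀`,
`0 < ε₀ < 1`), record kernel `κF`, restart chain `K = prodMkRight κ₀ ⊗ₖ prodMkLeft κF` with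
invariant law `Π = π₀ ⊗ₘ κF`, `κ̂` ANY split kernel of `(K, Π, ε₀)`, `G` a bounded measurable record
observable (a truncated Jarzynski weight, an end-point observable), `σ²_G` its Green–Kubo asymptotic
variance along `K` — equal, by the RESTART LAW of that file, to `Var_Π G + 2 Σ_{k≥1} C^{κ₀}_h(k)`
with `h = E[G | start]`.  New here, by composing GEN-18's regenerative central limit theorems
(`Scoring/RegenerativeCLT.lean`, `…Coverage.lean`, `…Studentized.lean`) with
`Scoring/RestartTimeAverage.restart_doeblin` / `invariant_restart`: from ANY initial law,
(i) `√R (Â_R − Π G) ⇒ N(0, e σ²_G)`; (ii) `P̂(|√R (Â_R − Π G)| ≤ r) → N(0, e σ²_G)([−r, r])`;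
(iii) for `σ²_G > 0` the studentised statistic `T_R = √R (Â_R − Π G) N̄_R / √V̂_R` has
`P̂(|T_R| ≤ z) → N(0,1)([−z, z])`: the error bar `z √V̂_R /(N̄_R √R)` printed next to a
non-equilibrium estimate of `Π(G)` is asymptotically exact, and its size is governed by the prior
sweep's autocorrelation of the conditional mean weight.  Printed counterpart NAMED ONLY:
Mykland–Tierney–Yu 1995 §3; nothing on NE-MCMC error bars is cited as a fact.

## Content (`e = ε₀.toReal`; hypotheses of `Scoring.restart_regenerative_confidence_sigma`)

* **`restart_regenerative_clt`** — for any `Y` with law `N(0, e σ²_G)`: `√R (Â_R − Π G) ⇒ Y`;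
* **`restart_regenerative_coverage`** — `r > 0`: the coverage probabilities converge;
* **`restart_studentized_coverage`** — `σ²_G > 0`, `z > 0`: `P̂(|T_R| ≤ z) → (gaussianReal 0 1)[−z, z]`.

NOT CLAIMED: any `ε₀` of a concrete sweep; rates; unbounded weights; the self-normalised (ratio)
Jarzynski estimator.
-/

noncomputable section

namespace Summit.Ventures.LatticeQCDFlow.Scoring

open MeasureTheory ProbabilityTheory Filter Finset Preorder
open Literature.Probability.MarkovChains
open scoped ENNReal Topology

variable {Ω E : Type*} [MeasurableSpace Ω] [MeasurableSpace E]

section Restart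

variable {κ₀ : Kernel Ω Ω} [IsMarkovKernel κ₀] {κF : Kernel Ω E} [IsMarkovKernel κF]
  {π₀ : Measure Ω} [IsProbabilityMeasure π₀] {ε : ℝ≥0∞}
  (κs : Kernel ((Ω × E) × Bool) ((Ω × E) × Bool)) [IsMarkovKernel κs]
  (μs : Measure ((Ω × E) × Bool)) [IsProbabilityMeasure μs]

/-- **THE TOUR ESTIMATOR OF A RECORD OBSERVABLE ALONG THE RESTART CHAIN IS ASYMPTOTICALLY NORMAL**:
for every split kernel `κ̂` of `(K, Π, ε₀)`, every initial law and every `Y` with law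
`N(0, e σ²_G)`: `√R (Â_R − Π G) ⇒ Y`.  (Instance argument `[IsProbabilityMeasure P̂]`:
`inferInstance` at every call site, see `Scoring/RegenerativeCLT.lean`.) -/
theorem restart_regenerative_clt (hπ₀ : Kernel.Invariant κ₀ π₀)
    (hmin : ∀ x {B : Set Ω}, MeasurableSet B → ε * π₀ B ≤ κ₀ x B) (hε0 : 0 < ε) (hε : ε < 1)
    (hκs : ∀ p, κs p = (ε • (π₀ ⊗ₘ κF)).map (fun y : Ω × E => (y, true))
      + ((1 - ε) • Doeblin.residualKernel ((Kernel.prodMkRight E κ₀) ⊗ₖ (Kernel.prodMkLeft (Ω × E) κF))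
          (π₀ ⊗ₘ κF) ε (fun p _ hS => restart_doeblin (κF := κF) hmin p hS) p.1).map
        (fun y : Ω × E => (y, false)))
    {G : Ω × E → ℝ} (hG : Measurable G) {C : ℝ} (hC : ∀ p, |G p| ≤ C)
    {Ω' : Type*} [MeasurableSpace Ω'] {P' : Measure Ω'} [IsProbabilityMeasure P'] {Y : Ω' → ℝ}
    (hY : HasLaw Y (gaussianReal 0 (ε.toReal * ((∫ p, (G p - ∫ p', G p' ∂(π₀ ⊗ₘ κF)) ^ 2 ∂(π₀ ⊗ₘ κF))
          + 2 * ∑' k, ∫ p, (G p - ∫ p', G p' ∂(π₀ ⊗ₘ κF))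
            * (kop ((Kernel.prodMkRight E κ₀) ⊗ₖ (Kernel.prodMkLeft (Ω × E) κF)))^[k + 1]
              (fun p => G p - ∫ p', G p' ∂(π₀ ⊗ₘ κF)) p ∂(π₀ ⊗ₘ κF))).toNNReal) P')
    [IsProbabilityMeasure (Kernel.trajMeasure (X := fun _ : ℕ => (Ω × E) × Bool) μs
        (fun n : ℕ => κs.comap (fun h : (i : ↥(Finset.Iic n)) → (Ω × E) × Bool =>
          h ⟨n, Finset.mem_Iic.2 le_rfl⟩) (measurable_pi_apply _)))] :
    TendstoInDistribution (fun (R : ℕ) (x : ℕ → (Ω × E) × Bool) =>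
        Real.sqrt R * (((∑ i ∈ Finset.range R, (∑' u, (if (∑ s ∈ Finset.range u, (if (x (s + 1)).2 then (1 : ℕ) else 0)) = i + 1 then (1 : ℝ) else 0) * G (x u).1)) / (∑ i ∈ Finset.range R, (∑' u, (if (∑ s ∈ Finset.range u, (if (x (s + 1)).2 then (1 : ℕ) else 0)) = i + 1 then (1 : ℝ) else 0)))) - ∫ p, G p ∂(π₀ ⊗ₘ κF)))
      atTop Y (fun _ => (Kernel.trajMeasure (X := fun _ : ℕ => (Ω × E) × Bool) μs
        (fun n : ℕ => κs.comap (fun h : (i : ↥(Finset.Iic n)) → (Ω × E) × Bool =>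
          h ⟨n, Finset.mem_Iic.2 le_rfl⟩) (measurable_pi_apply _)))) P' :=
  regenerative_estimator_clt κs μs
    (κ := ((Kernel.prodMkRight E κ₀) ⊗ₖ (Kernel.prodMkLeft (Ω × E) κF))) (ν := π₀ ⊗ₘ κF)
    (hmin := fun p _ hS => restart_doeblin (κF := κF) hmin p hS) (invariant_restart hπ₀) hε0 hε hκs
    hG hC hY

/-- **Coverage probabilities of the restart chain's tour estimator converge to Gaussian values**:
for every `r > 0`, `P̂(|√R (Â_R − Π G)| ≤ r) → (gaussianReal 0 (e σ²_G)) [−r, r]`. -/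
theorem restart_regenerative_coverage (hπ₀ : Kernel.Invariant κ₀ π₀)
    (hmin : ∀ x {B : Set Ω}, MeasurableSet B → ε * π₀ B ≤ κ₀ x B) (hε0 : 0 < ε) (hε : ε < 1)
    (hκs : ∀ p, κs p = (ε • (π₀ ⊗ₘ κF)).map (fun y : Ω × E => (y, true))
      + ((1 - ε) • Doeblin.residualKernel ((Kernel.prodMkRight E κ₀) ⊗ₖ (Kernel.prodMkLeft (Ω × E) κF))
          (π₀ ⊗ₘ κF) ε (fun p _ hS => restart_doeblin (κF := κF) hmin p hS) p.1).map
        (fun y : Ω × E => (y, false)))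
    {G : Ω × E → ℝ} (hG : Measurable G) {C : ℝ} (hC : ∀ p, |G p| ≤ C) {r : ℝ} (hr : 0 < r) :
    Tendsto (fun R : ℕ => (Kernel.trajMeasure (X := fun _ : ℕ => (Ω × E) × Bool) μs
        (fun n : ℕ => κs.comap (fun h : (i : ↥(Finset.Iic n)) → (Ω × E) × Bool =>
          h ⟨n, Finset.mem_Iic.2 le_rfl⟩) (measurable_pi_apply _))).real
      {x | |Real.sqrt R * (((∑ i ∈ Finset.range R, (∑' u, (if (∑ s ∈ Finset.range u, (if (x (s + 1)).2 then (1 : ℕ) else 0)) = i + 1 then (1 : ℝ) else 0) * G (x u).1)) / (∑ i ∈ Finset.range R, (∑' u, (if (∑ s ∈ Finset.range u, (if (x (s + 1)).2 then (1 : ℕ) else 0)) = i + 1 then (1 : ℝ) else 0)))) - ∫ p, G p ∂(π₀ ⊗ₘ κF))| ≤ r})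
      atTop (𝓝 ((gaussianReal 0 (ε.toReal * ((∫ p, (G p - ∫ p', G p' ∂(π₀ ⊗ₘ κF)) ^ 2 ∂(π₀ ⊗ₘ κF))
          + 2 * ∑' k, ∫ p, (G p - ∫ p', G p' ∂(π₀ ⊗ₘ κF))
            * (kop ((Kernel.prodMkRight E κ₀) ⊗ₖ (Kernel.prodMkLeft (Ω × E) κF)))^[k + 1]
              (fun p => G p - ∫ p', G p' ∂(π₀ ⊗ₘ κF)) p ∂(π₀ ⊗ₘ κF))).toNNReal).real (Set.Icc (-r) r))) :=
  regenerative_estimator_coverage κs μs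
    (κ := ((Kernel.prodMkRight E κ₀) ⊗ₖ (Kernel.prodMkLeft (Ω × E) κF))) (ν := π₀ ⊗ₘ κF)
    (hmin := fun p _ hS => restart_doeblin (κF := κF) hmin p hS) (invariant_restart hπ₀) hε0 hε hκs
    hG hC hr

/-- **Asymptotically exact studentised error bars for non-equilibrium estimates with correlated
restarts**: if `σ²_G > 0`, then for every `z > 0`, with `T_R = √R (Â_R − Π G) N̄_R / √V̂_R`,
`P̂(|T_R| ≤ z) → (gaussianReal 0 1) [−z, z]`. -/
theorem restart_studentized_coverage (hπ₀ : Kernel.Invariant κ₀ π₀)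
    (hmin : ∀ x {B : Set Ω}, MeasurableSet B → ε * π₀ B ≤ κ₀ x B) (hε0 : 0 < ε) (hε : ε < 1)
    (hκs : ∀ p, κs p = (ε • (π₀ ⊗ₘ κF)).map (fun y : Ω × E => (y, true))
      + ((1 - ε) • Doeblin.residualKernel ((Kernel.prodMkRight E κ₀) ⊗ₖ (Kernel.prodMkLeft (Ω × E) κF))
          (π₀ ⊗ₘ κF) ε (fun p _ hS => restart_doeblin (κF := κF) hmin p hS) p.1).map
        (fun y : Ω × E => (y, false)))
    {G : Ω × E → ℝ} (hG : Measurable G) {C : ℝ} (hC : ∀ p, |G p| ≤ C)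
    (hσ : 0 < ((∫ p, (G p - ∫ p', G p' ∂(π₀ ⊗ₘ κF)) ^ 2 ∂(π₀ ⊗ₘ κF))
          + 2 * ∑' k, ∫ p, (G p - ∫ p', G p' ∂(π₀ ⊗ₘ κF))
            * (kop ((Kernel.prodMkRight E κ₀) ⊗ₖ (Kernel.prodMkLeft (Ω × E) κF)))^[k + 1]
              (fun p => G p - ∫ p', G p' ∂(π₀ ⊗ₘ κF)) p ∂(π₀ ⊗ₘ κF))) {z : ℝ} (hz : 0 < z) :
    Tendsto (fun R : ℕ => (Kernel.trajMeasure (X := fun _ : ℕ => (Ω × E) × Bool) μs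
        (fun n : ℕ => κs.comap (fun h : (i : ↥(Finset.Iic n)) → (Ω × E) × Bool =>
          h ⟨n, Finset.mem_Iic.2 le_rfl⟩) (measurable_pi_apply _))).real
      {x | |Real.sqrt R * (((∑ i ∈ Finset.range R, (∑' u, (if (∑ s ∈ Finset.range u, (if (x (s + 1)).2 then (1 : ℕ) else 0)) = i + 1 then (1 : ℝ) else 0) * G (x u).1)) / (∑ i ∈ Finset.range R, (∑' u, (if (∑ s ∈ Finset.range u, (if (x (s + 1)).2 then (1 : ℕ) else 0)) = i + 1 then (1 : ℝ) else 0)))) - ∫ p, G p ∂(π₀ ⊗ₘ κF)) * ((∑ i ∈ Finset.range R, (∑' u, (if (∑ s ∈ Finset.range u, (if (x (s + 1)).2 then (1 : ℕ) else 0)) = i + 1 then (1 : ℝ) else 0))) / R) / Real.sqrt ((∑ i ∈ Finset.range R, ((∑' u, (if (∑ s ∈ Finset.range u, (if (x (s + 1)).2 then (1 : ℕ) else 0)) = i + 1 then (1 : ℝ) else 0) * G (x u).1) - ((∑ i ∈ Finset.range R, (∑' u, (if (∑ s ∈ Finset.range u, (if (x (s + 1)).2 then (1 : ℕ) else 0))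 = i + 1 then (1 : ℝ) else 0) * G (x u).1)) / (∑ i ∈ Finset.range R, (∑' u, (if (∑ s ∈ Finset.range u, (if (x (s + 1)).2 then (1 : ℕ) else 0)) = i + 1 then (1 : ℝ) else 0)))) * (∑' u, (if (∑ s ∈ Finset.range u, (if (x (s + 1)).2 then (1 : ℕ) else 0)) = i + 1 then (1 : ℝ) else 0))) ^ 2) / R)| ≤ z})
      atTop (𝓝 ((gaussianReal 0 1).real (Set.Icc (-z) z))) :=
  regenerative_studentized_coverage κs μs
    (κ := ((Kernel.prodMkRight E κ₀) ⊗ₖ (Kernel.prodMkLeft (Ω × E) κF))) (ν := π₀ ⊗ₘ κF)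
    (hmin := fun p _ hS => restart_doeblin (κF := κF) hmin p hS) (invariant_restart hπ₀) hε0 hε hκs
    hG hC hσ hz

end Restart

end Summit.Ventures.LatticeQCDFlow.Scoring

end
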